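import Summits.HubbardSuperconductivity.HubbardSuperconductivity.Theorems.LevyLogBootstrapDressHalfFilledPlaquetteBandGap
import Summits.HubbardSuperconductivity.HubbardSuperconductivity.Theorems.LevyLogBootstrapDressHalfFilledBandProjections
import Summits.HubbardSuperconductivity.HubbardSuperconductivity.Theorems.LevyLogBootstrapDressHalfFilledSectorFloors
import Literature.MathematicalPhysics.QuantumLattice.TorusPlaquetteDictionaryMap
import Literature.MathematicalPhysics.QuantumLattice.HubbardModelParticleHoleProofs
import HarnessLib

/-!
# Route `LevyLogBootstrap`, crux `DressHalfFilled` (stmt-HubbardSuperconductivity-8148), stub 2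
# `stub_plaquetteDictionary`: clause (c) for the dictionary map `Φ = dictionaryMap M U`

Support file: the EXHAUSTION clause (c) of `PlaquetteDictionary` for the tree's dictionary map
`TorusPlaquette.dictionaryMap M U` (Literature `TorusPlaquetteDictionaryMap`, whose clauses (a) isometry and (b)
sectors/energies are proved there). For `M ≥ 2`, a coupling `U` carrying the plaquette data (W3)–(W5) (explicit
hypotheses) and a boson number `N_b ≤ M²` (`dictionary_exhaustion`):

* the sector energy of the intra-plaquette Hamiltonian `H_in` of the `2M × 2M` torus on the electron sector
  `((2M)² − 2N_b, S^z = 0)` is EXACTLY `E₀(N_b) = (M² − N_b) e₀ + N_b e₂`;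
* every sector ground state `ψ` (`H_in ψ = E₀(N_b) ψ`) is `Φ φ` for a (unique) `φ` of the spin sector
  `S^z_tot = N_b − M²/2`, namely `φ σ = ⟨column σ, ψ⟩`.

Proof: the local band gap of one plaquette (`plaquette_bandGap`, from (W3)–(W5)) is transported along the plaquette
embeddings `plaqSiteEmb M R` (`re_form_defect_jwEmbed`) and summed over the `M²` plaquettes
(`TorusPlaquette.hamiltonian_intra_eq_sum_jwEmbed_plaquetteHamiltonian`): `H_in − E₀ ≥ γ Σ_R (1 − (P_band)_R)` on the sector,
so the sector energy is `≥ E₀` (and `= E₀` at a column of `Φ`), and a ground state has zero defect at every plaquette,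
i.e. is fixed by every embedded band projection; the expansion `eq_sum_of_fixed_by_bandProj` along the Koszul
product states (fixed by the embedded projections by `ClusterProduct.Partition.jwEmbed_mulVec_prodFamily`) then
writes it as a combination of the columns of `Φ`, with coefficients supported on the right spin sector.

References: W.-F. Tsai, S. A. Kivelson, PRB 73 (2006) 214510, App. A; H. Yao, W.-F. Tsai, S. A. Kivelson, PRB 76 (2007)
161104(R), eq. (2). All statements are [folklore]; no definition is introduced.
-/

set_option linter.dupNamespace false

noncomputable section

namespace Summit.HubbardSuperconductivity.HubbardSuperconductivity.Theorems.LevyLogBootstrap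

open Matrix Finset Literature.MathematicalPhysics.QuantumLattice Literature.Probability.LatticeModels
open Literature.MathematicalPhysics.QuantumLattice.TorusPlaquette
open Summit.HubbardSuperconductivity.HubbardSuperconductivity.Theorems.CooperPairDMottWalk
open scoped ComplexOrder

/-! ### Defects of orthogonal projections -/

section Defect

variable {n : Type*} [Fintype n]

/-- For an orthogonal projection `P` (`Pᴴ = P = P²`): `‖v‖² − ⟨v, P v⟩ = ‖v − P v‖²`. [folklore] -/
theorem star_sub_proj_dotProduct {P : Matrix n n ℂ} (hPh : Pᴴ = P) (hPP : P * P = P) (v : n → ℂ) :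
    star (v - P *ᵥ v) ⬝ᵥ (v - P *ᵥ v) = star v ⬝ᵥ v - star v ⬝ᵥ (P *ᵥ v) := by
  have h1 : star (P *ᵥ v) ⬝ᵥ v = star v ⬝ᵥ (P *ᵥ v) := by
    rw [star_mulVec, hPh, ← dotProduct_mulVec]
  have h2 : star (P *ᵥ v) ⬝ᵥ (P *ᵥ v) = star v ⬝ᵥ (P *ᵥ v) := by
    rw [star_mulVec, hPh, ← dotProduct_mulVec, mulVec_mulVec, hPP]
  rw [star_sub, sub_dotProduct, dotProduct_sub, dotProduct_sub, h1, h2, sub_self, sub_zero]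

/-- The defect `‖v‖² − Re⟨v, P v⟩` of an orthogonal projection is nonnegative. [folklore] -/
theorem re_defect_nonneg_of_proj {P : Matrix n n ℂ} (hPh : Pᴴ = P) (hPP : P * P = P) (v : n → ℂ) :
    0 ≤ (star v ⬝ᵥ v).re - (star v ⬝ᵥ (P *ᵥ v)).re := by
  rw [← Complex.sub_re, ← star_sub_proj_dotProduct hPh hPP v]
  exact (Complex.nonneg_iff.1 (dotProduct_star_self_nonneg _)).1

/-- A vector with zero defect is fixed by the projection. [folklore] -/
theorem proj_mulVec_eq_self_of_defect_eq_zero {P : Matrix n n ℂ} (hPh : Pᴴ = P) (hPP : P * P = P) {v : n → ℂ}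
    (h : (star v ⬝ᵥ v).re - (star v ⬝ᵥ (P *ᵥ v)).re = 0) : P *ᵥ v = v := by
  have him : (star (v - P *ᵥ v) ⬝ᵥ (v - P *ᵥ v)).im = 0 := by
    rw [ThermodynamicLimit.star_dotProduct_self_eq_re]; exact Complex.ofReal_im _
  have hre : (star (v - P *ᵥ v) ⬝ᵥ (v - P *ᵥ v)).re = 0 := by
    rw [star_sub_proj_dotProduct hPh hPP v, Complex.sub_re, h]
  have h0 : star (v - P *ᵥ v) ⬝ᵥ (v - P *ᵥ v) = 0 := Complex.ext hre him
  have := dotProduct_star_self_eq_zero.1 h0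
  exact (sub_eq_zero.1 this).symm

end Defect

/-- The embedded band projections `(e)_* (|0h⟩⟨0h| + |2h⟩⟨2h|)` are orthogonal projections. [folklore] -/
theorem jwEmbed_bandProj_herm_idem {L : ℕ} (U : ℝ) (e : PlaquetteSite ↪o FermionTorus 2 L) :
    (jwEmbed (orbEmb e) (vecMulVec (plaquetteStates U 0) (star (plaquetteStates U 0)) +
        vecMulVec (plaquetteStates U 1) (star (plaquetteStates U 1))))ᴴ =
      jwEmbed (orbEmb e) (vecMulVec (plaquetteStates U 0) (star (plaquetteStates U 0)) +
        vecMulVec (plaquetteStates U 1) (star (plaquetteStates U 1))) ∧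
    jwEmbed (orbEmb e) (vecMulVec (plaquetteStates U 0) (star (plaquetteStates U 0)) +
        vecMulVec (plaquetteStates U 1) (star (plaquetteStates U 1))) *
      jwEmbed (orbEmb e) (vecMulVec (plaquetteStates U 0) (star (plaquetteStates U 0)) +
        vecMulVec (plaquetteStates U 1) (star (plaquetteStates U 1))) =
      jwEmbed (orbEmb e) (vecMulVec (plaquetteStates U 0) (star (plaquetteStates U 0)) +
        vecMulVec (plaquetteStates U 1) (star (plaquetteStates U 1))) := by
  set s : Fin 2 → Fock (Orb PlaquetteSite) := plaquetteStates U with hs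
  have h01 : star (s 0) ⬝ᵥ s 1 = 0 := star_plaquetteStates_dotProduct (U := U) (by decide : (0 : Fin 2) ≠ 1)
  have h10 : star (s 1) ⬝ᵥ s 0 = 0 := star_plaquetteStates_dotProduct (U := U) (by decide : (1 : Fin 2) ≠ 0)
  constructor
  · rw [← jwEmbed_conjTranspose, conjTranspose_add, conjTranspose_vecMulVec, conjTranspose_vecMulVec, star_star,
      star_star]
  · have hsq : (vecMulVec (s 0) (star (s 0)) + vecMulVec (s 1) (star (s 1))) *
        (vecMulVec (s 0) (star (s 0)) + vecMulVec (s 1) (star (s 1))) =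
          vecMulVec (s 0) (star (s 0)) + vecMulVec (s 1) (star (s 1)) := by
      rw [add_mul, mul_add, mul_add, vecMulVec_mul_vecMulVec, vecMulVec_mul_vecMulVec,
        vecMulVec_mul_vecMulVec, vecMulVec_mul_vecMulVec, (plaquetteStates_spec U 0).1, (plaquetteStates_spec U 1).1,
        h01, h10, one_smul, one_smul, zero_smul, zero_smul, vecMulVec_zero, vecMulVec_zero, add_zero, zero_add]
    rw [← jwEmbed_mul', hsq]

variable {M : ℕ}

/-- Rank-one operators of definite-particle-number vectors preserve the fermion parity. [folklore] -/
theorem isParityPreserving_vecMulVec {κ : Type*} {a : ℕ} {φ : Fock κ} (hφ : IsNParticle a φ) :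
    TwoCluster.IsParityPreserving (vecMulVec φ (star φ)) := by
  intro s t hst
  rw [vecMulVec_apply, Pi.star_apply] at hst
  have hs : s.card = a := by by_contra h; exact hst (by rw [hφ s h, zero_mul])
  have ht : t.card = a := by by_contra h; exact hst (by rw [hφ t h, star_zero, mul_zero])
  rw [hs, ht]

/-- The plaquette images of distinct coarse sites are disjoint. [folklore] -/
theorem disjoint_map_plaqSiteEmb {R R' : FermionTorus 2 M} (h : R ≠ R') :
    Disjoint ((Finset.univ : Finset PlaquetteSite).map (plaqSiteEmb M R).toEmbedding)
      ((Finset.univ : Finset PlaquetteSite).map (plaqSiteEmb M R').toEmbedding) := by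
  rw [Finset.disjoint_left]
  intro x hx hx'
  obtain ⟨a, -, rfl⟩ := Finset.mem_map.1 hx
  obtain ⟨b, -, hb⟩ := Finset.mem_map.1 hx'
  exact plaqSite_ne_of_ne (Ne.symm h) b a hb

/-- Orbital bookkeeping of the plaquette cover: `|Orb Λ_2| · M² = |Orb Λ_{2M}|`. [bookkeeping] -/
theorem card_orb_plaquette_mul_card :
    Fintype.card (Orb PlaquetteSite) * Fintype.card (FermionTorus 2 M) = Fintype.card (Orb (FermionTorus 2 (2 * M))) := by
  rw [card_orb, card_orb, card_plaquetteSite, card_fermionTorus_two, card_fermionTorus_two]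
  ring

/-- The Koszul product state of an assignment of plaquette states is a unit vector. [folklore] -/
theorem prodFamily_plaquetteStates_unit (U : ℝ) (κ : FermionTorus 2 M → Fin 2) :
    star ((plaquettePartition M).prodFamily fun R => plaquetteStates U (κ R)) ⬝ᵥ
        (plaquettePartition M).prodFamily (fun R => plaquetteStates U (κ R)) = 1 :=
  (plaquettePartition M).star_prodFamily_dotProduct_self _ fun R => (plaquetteStates_spec U (κ R)).1

/-- The Koszul product state of an assignment of plaquette states is fixed by the embedded projections onto its
own factors (an even one-plaquette operator acts on its factor). [folklore] -/
theorem prodFamily_plaquetteStates_fixed (U : ℝ) (κ : FermionTorus 2 M → Fin 2) (R : FermionTorus 2 M) :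
    jwEmbed (orbEmb (plaqSiteEmb M R)) (vecMulVec (plaquetteStates U (κ R)) (star (plaquetteStates U (κ R)))) *ᵥ
        (plaquettePartition M).prodFamily (fun R => plaquetteStates U (κ R)) =
      (plaquettePartition M).prodFamily fun R => plaquetteStates U (κ R) := by
  have h := (plaquettePartition M).jwEmbed_mulVec_prodFamily
    (isParityPreserving_vecMulVec (isNParticle_plaquetteStates U (κ R))) R (fun R => plaquetteStates U (κ R))
  rw [plaquettePartition_emb] at h
  rw [show orbEmb (plaqSiteEmb M R) = plaqOrbEmb M R from rfl, h, vecMulVec_mulVec, op_smul_eq_smul,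
    (plaquetteStates_spec U (κ R)).1, one_smul, Function.update_eq_self]

/-- **Clause (c) of the plaquette-boson dictionary for `Φ = dictionaryMap M U`.** For `M ≥ 2`, the plaquette data
(W3)–(W5) and `N_b ≤ M²`: the sector energy of the intra-plaquette Hamiltonian on `((2M)² − 2N_b, 0)` is
`(M² − N_b) e₀ + N_b e₂`, and every sector ground state is `Φ φ` with `φ` in the spin sector `S^z_tot = N_b − M²/2`.
[cite: TsaiKivelson2006, App. A] -/
theorem dictionary_exhaustion [NeZero M] (hM : 2 ≤ M) (U : ℝ)
    (hW3 : ∀ n : ℕ, n ≤ 8 → n ≠ 2 → n ≠ 4 →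
      (4 - (n : ℝ)) * groundEnergyAt plaquetteGraph 1 U 2 + ((n : ℝ) - 2) * groundEnergyAt plaquetteGraph 1 U 4 <
        2 * groundEnergyAt plaquetteGraph 1 U n)
    (hW4a : ∀ φ₁ φ₂ : Fock (Orb PlaquetteSite), IsGroundStateInSector (plaquetteHamiltonian U) 4 0 φ₁ →
      IsGroundStateInSector (plaquetteHamiltonian U) 4 0 φ₂ → ∃ a : ℂ, φ₂ = a • φ₁)
    (hW4b : ∀ φ₁ φ₂ : Fock (Orb PlaquetteSite), IsGroundStateInSector (plaquetteHamiltonian U) 2 0 φ₁ →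
      IsGroundStateInSector (plaquetteHamiltonian U) 2 0 φ₂ → ∃ a : ℂ, φ₂ = a • φ₁)
    (hW5a : ∀ m : ℝ, m = 1 ∨ m = -1 ∨ m = 2 ∨ m = -2 →
      (plaquetteHamiltonian U).minEnergyOn (szSector 4 0) < (plaquetteHamiltonian U).minEnergyOn (szSector 4 m))
    (hW5b : ∀ m : ℝ, m = 1 ∨ m = -1 →
      (plaquetteHamiltonian U).minEnergyOn (szSector 2 0) < (plaquetteHamiltonian U).minEnergyOn (szSector 2 m))
    {Nb : ℕ} (hNb : Nb ≤ M ^ 2) :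
    (hamiltonian (fermionTorusGraph 2 (2 * M) \
        SimpleGraph.comap (fun x : FermionTorus 2 (2 * M) => fun i : Fin 2 => ((ofLex x) i : ℕ) / 2) ⊤) 1 U).minEnergyOn
        (szSector (Λ := FermionTorus 2 (2 * M)) ((2 * M) ^ 2 - 2 * Nb) 0) =
      ((M : ℝ) ^ 2 - Nb) * plaquetteEnergy U 0 + Nb * plaquetteEnergy U 2 ∧
    ∀ ψ : Fock (Orb (FermionTorus 2 (2 * M))), ψ ∈ szSector (Λ := FermionTorus 2 (2 * M)) ((2 * M) ^ 2 - 2 * Nb) 0 →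
      hamiltonian (fermionTorusGraph 2 (2 * M) \
          SimpleGraph.comap (fun x : FermionTorus 2 (2 * M) => fun i : Fin 2 => ((ofLex x) i : ℕ) / 2) ⊤) 1 U *ᵥ ψ =
        ((((M : ℝ) ^ 2 - Nb) * plaquetteEnergy U 0 + Nb * plaquetteEnergy U 2 : ℝ) : ℂ) • ψ →
      ∃ φ : TensorIndex (TorusSite 2 M) 2 → ℂ,
        φ ∈ spinZSector (Λ := TorusSite 2 M) 1 ((Nb : ℝ) - (M : ℝ) ^ 2 / 2) ∧ ψ = dictionaryMap M U *ᵥ φ := by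
  set Hin := hamiltonian (fermionTorusGraph 2 (2 * M) \
    SimpleGraph.comap (fun x : FermionTorus 2 (2 * M) => fun i : Fin 2 => ((ofLex x) i : ℕ) / 2) ⊤) 1 U with hHin
  set e₀ := plaquetteEnergy U 0 with he₀
  set e₂ := plaquetteEnergy U 2 with he₂
  set E₀ : ℝ := ((M : ℝ) ^ 2 - Nb) * e₀ + Nb * e₂ with hE₀
  set s : Fin 2 → Fock (Orb PlaquetteSite) := plaquetteStates U with hs
  set Pb : Matrix (Finset (Orb PlaquetteSite)) (Finset (Orb PlaquetteSite)) ℂ :=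
    vecMulVec (s 0) (star (s 0)) + vecMulVec (s 1) (star (s 1)) with hPb
  set μ : ℝ := (e₀ - e₂) / 2 with hμ
  set α : ℝ := 2 * e₂ - e₀ with hα
  set Q : Matrix (Finset (Orb PlaquetteSite)) (Finset (Orb PlaquetteSite)) ℂ :=
    plaquetteHamiltonian U - (μ : ℂ) • totalNumber with hQ
  -- the local band gap and its transport
  obtain ⟨γ, hγ, hloc⟩ := plaquette_bandGap U hW3 hW4a hW4b hW5a hW5b
  have hA : (plaquetteHamiltonian U).IsHermitian := plaquetteHamiltonian_isHermitian U
  have hQh : Q.IsHermitian := by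
    rw [hQ]
    exact hA.sub ((totalNumber_isHermitian (Λ := PlaquetteSite)).smul
      (by rw [isSelfAdjoint_iff, Complex.star_def, Complex.conj_ofReal]))
  have hPbh : Pb.IsHermitian := by
    rw [hPb, IsHermitian, conjTranspose_add, conjTranspose_vecMulVec, conjTranspose_vecMulVec, star_star, star_star]
  have hdisj : ∀ R ∈ (Finset.univ : Finset (FermionTorus 2 M)), ∀ R' ∈ (Finset.univ : Finset (FermionTorus 2 M)),
      R ≠ R' → Disjoint ((Finset.univ : Finset PlaquetteSite).map (plaqSiteEmb M R).toEmbedding)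
        ((Finset.univ : Finset PlaquetteSite).map (plaqSiteEmb M R').toEmbedding) :=
    fun R _ R' _ hne => disjoint_map_plaqSiteEmb hne
  have hcover := biUnion_map_plaqSiteEmb_eq_univ (M := M)
  -- the defect sum
  have hPR : ∀ R : FermionTorus 2 M, (jwEmbed (orbEmb (plaqSiteEmb M R)) Pb)ᴴ = jwEmbed (orbEmb (plaqSiteEmb M R)) Pb ∧
      jwEmbed (orbEmb (plaqSiteEmb M R)) Pb * jwEmbed (orbEmb (plaqSiteEmb M R)) Pb = jwEmbed (orbEmb (plaqSiteEmb M R)) Pb :=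
    fun R => jwEmbed_bandProj_herm_idem U (plaqSiteEmb M R)
  have hdefect_nn : ∀ (ψ : Fock (Orb (FermionTorus 2 (2 * M)))) (R : FermionTorus 2 M),
      0 ≤ (star ψ ⬝ᵥ ψ).re - (star ψ ⬝ᵥ (jwEmbed (orbEmb (plaqSiteEmb M R)) Pb *ᵥ ψ)).re :=
    fun ψ R => re_defect_nonneg_of_proj (hPR R).1 (hPR R).2 ψ
  have hsumQ : ∑ R : FermionTorus 2 M, jwEmbed (orbEmb (plaqSiteEmb M R)) Q = Hin - (μ : ℂ) • totalNumber := by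
    rw [hHin, hamiltonian_intra_eq_sum_jwEmbed_plaquetteHamiltonian hM U,
      ← sum_jwEmbed_totalNumber_eq_of_cover _ (fun R => plaqSiteEmb M R) hdisj (by convert hcover using 2),
      Finset.smul_sum, ← Finset.sum_sub_distrib]
    refine Finset.sum_congr rfl fun R _ => ?_
    rw [hQ, jwEmbed_sub', jwEmbed_smul']
    rfl
  have hdef : ∀ ψ : Fock (Orb (FermionTorus 2 (2 * M))),
      γ * ∑ R : FermionTorus 2 M, ((star ψ ⬝ᵥ ψ).re - (star ψ ⬝ᵥ (jwEmbed (orbEmb (plaqSiteEmb M R)) Pb *ᵥ ψ)).re) ≤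
        (star ψ ⬝ᵥ (Hin *ᵥ ψ)).re - μ * (star ψ ⬝ᵥ (totalNumber *ᵥ ψ)).re - α * (M : ℝ) ^ 2 * (star ψ ⬝ᵥ ψ).re := by
    intro ψ
    have hR : ∀ R : FermionTorus 2 M, γ * ((star ψ ⬝ᵥ ψ).re -
        (star ψ ⬝ᵥ (jwEmbed (orbEmb (plaqSiteEmb M R)) Pb *ᵥ ψ)).re) ≤
          (star ψ ⬝ᵥ (jwEmbed (orbEmb (plaqSiteEmb M R)) Q *ᵥ ψ)).re - α * (star ψ ⬝ᵥ ψ).re :=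
      fun R => re_form_defect_jwEmbed (e := orbEmb (plaqSiteEmb M R)) hQh hPbh hloc ψ
    have hsum := Finset.sum_le_sum fun R (_ : R ∈ (Finset.univ : Finset (FermionTorus 2 M))) => hR R
    rw [← Finset.mul_sum] at hsum
    simp only [Finset.sum_sub_distrib, Finset.sum_const, Finset.card_univ, card_fermionTorus_two, nsmul_eq_mul] at hsum
    have hformQ : ∑ R : FermionTorus 2 M, (star ψ ⬝ᵥ (jwEmbed (orbEmb (plaqSiteEmb M R)) Q *ᵥ ψ)).re =
        (star ψ ⬝ᵥ (Hin *ᵥ ψ)).re - μ * (star ψ ⬝ᵥ (totalNumber *ᵥ ψ)).re := by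
      rw [← Complex.re_sum, ← dotProduct_sum, ← sum_mulVec, hsumQ, sub_mulVec, smul_mulVec, dotProduct_sub,
        dotProduct_smul, smul_eq_mul, Complex.sub_re, Complex.re_ofReal_mul]
    rw [hformQ] at hsum
    simp only [Finset.sum_sub_distrib, Finset.sum_const, Finset.card_univ, card_fermionTorus_two, nsmul_eq_mul]
    push_cast at hsum ⊢
    linarith
  -- bookkeeping on the sector
  have hsq : (2 * M) ^ 2 = 4 * M ^ 2 := by ring
  have hsplit : (2 * M) ^ 2 - 2 * Nb = (2 * M ^ 2 - Nb) + (2 * M ^ 2 - Nb) := by rw [hsq]; omega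
  have hcardle : 2 * M ^ 2 - Nb ≤ Fintype.card (FermionTorus 2 (2 * M)) := by rw [card_fermionTorus_two, hsq]; omega
  have hbook : α * (M : ℝ) ^ 2 + μ * (((2 * M) ^ 2 - 2 * Nb : ℕ) : ℝ) = E₀ := by
    have hle : 2 * Nb ≤ (2 * M) ^ 2 := by rw [hsq]; omega
    rw [hα, hμ, hE₀]
    push_cast [Nat.cast_sub hle]
    ring
  have hsector : ∀ ψ : Fock (Orb (FermionTorus 2 (2 * M))), ψ ∈ szSector (Λ := FermionTorus 2 (2 * M)) ((2 * M) ^ 2 - 2 * Nb) 0 ↔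
      IsInSector (2 * M ^ 2 - Nb) (2 * M ^ 2 - Nb) ψ := by
    intro ψ
    rw [hsplit, ← mem_szSector_iff_isInSector]
    norm_num
  have hform : ∀ ψ : Fock (Orb (FermionTorus 2 (2 * M))), IsInSector (2 * M ^ 2 - Nb) (2 * M ^ 2 - Nb) ψ →
      E₀ * (star ψ ⬝ᵥ ψ).re + γ * ∑ R : FermionTorus 2 M, ((star ψ ⬝ᵥ ψ).re -
        (star ψ ⬝ᵥ (jwEmbed (orbEmb (plaqSiteEmb M R)) Pb *ᵥ ψ)).re) ≤ (star ψ ⬝ᵥ (Hin *ᵥ ψ)).re := by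
    intro ψ hψ
    have hN : totalNumber *ᵥ ψ = (((2 * M) ^ 2 - 2 * Nb : ℕ) : ℂ) • ψ := by
      rw [hsplit]; exact totalNumber_mulVec_of_isInSector hψ
    have h := hdef ψ
    rw [hN, dotProduct_smul, smul_eq_mul, ← Complex.ofReal_natCast, Complex.re_ofReal_mul] at h
    have key : μ * ((((2 * M) ^ 2 - 2 * Nb : ℕ) : ℝ) * (star ψ ⬝ᵥ ψ).re) + α * (M : ℝ) ^ 2 * (star ψ ⬝ᵥ ψ).re =
        E₀ * (star ψ ⬝ᵥ ψ).re := by rw [← hbook]; ring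
    linarith
  have hsumnn : ∀ ψ : Fock (Orb (FermionTorus 2 (2 * M))), 0 ≤ ∑ R : FermionTorus 2 M, ((star ψ ⬝ᵥ ψ).re -
      (star ψ ⬝ᵥ (jwEmbed (orbEmb (plaqSiteEmb M R)) Pb *ᵥ ψ)).re) :=
    fun ψ => Finset.sum_nonneg fun R _ => hdefect_nn ψ R
  -- part 1: `E₀ ≤ min`
  have hge : E₀ ≤ Hin.minEnergyOn (szSector (Λ := FermionTorus 2 (2 * M)) ((2 * M) ^ 2 - 2 * Nb) 0) := by
    have key := le_minEnergyOn_szSector_of_sectorBound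
      (G := fermionTorusGraph 2 (2 * M) \
        SimpleGraph.comap (fun x : FermionTorus 2 (2 * M) => fun i : Fin 2 => ((ofLex x) i : ℕ) / 2) ⊤) 1 U E₀ hcardle hcardle
      (fun v hv => by have := hform v hv; nlinarith [hsumnn v, hγ])
    rw [hsplit]
    norm_num at key
    exact key
  -- part 1: `min ≤ E₀` at a column of `Φ` with `M² − N_b` down spins
  have hle : Hin.minEnergyOn (szSector (Λ := FermionTorus 2 (2 * M)) ((2 * M) ^ 2 - 2 * Nb) 0) ≤ E₀ := by
    have hcard : M ^ 2 - Nb ≤ (Finset.univ : Finset (TorusSite 2 M)).card := by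
      rw [Finset.card_univ, card_torusSite_two]; omega
    obtain ⟨S, -, hS⟩ := Finset.exists_subset_card_eq hcard
    set σ : TensorIndex (TorusSite 2 M) 2 := fun y => if y ∈ S then 1 else 0 with hσ
    have hw : downWeight σ = M ^ 2 - Nb := by
      rw [downWeight]
      have h1 : ∀ y, ((σ y : Fin 2) : ℕ) = if y ∈ S then 1 else 0 := fun y => by
        simp only [hσ]; split_ifs <;> rfl
      simp_rw [h1]
      rw [Finset.sum_ite, Finset.sum_const_zero, add_zero, Finset.sum_const, smul_eq_mul, mul_one,
        Finset.filter_mem_eq_inter, Finset.univ_inter, hS]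
    have hcol := col_mem_szSector U σ
    have hcolE := hamiltonian_intra_mulVec_col hM U σ
    have heq : 2 * (M ^ 2 + downWeight σ) = (2 * M) ^ 2 - 2 * Nb := by rw [hw, hsq]; omega
    rw [heq] at hcol
    rw [hw] at hcolE
    have hunit : star ((plaquettePartition M).prodFamily (plaqFamily U σ)) ⬝ᵥ
        (plaquettePartition M).prodFamily (plaqFamily U σ) = 1 := by
      rw [star_col_dotProduct_col, if_pos rfl]
    have hE : ((M : ℂ) ^ 2 - ((M ^ 2 - Nb : ℕ) : ℂ)) * (plaquetteEnergy U 2 : ℂ) +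
        ((M ^ 2 - Nb : ℕ) : ℂ) * (plaquetteEnergy U 0 : ℂ) = ((E₀ : ℝ) : ℂ) := by
      rw [hE₀, Nat.cast_sub hNb]
      push_cast
      ring
    rw [hE] at hcolE
    have := minEnergyOn_le_rayleigh_of_mem
      (LiebThm1.hamiltonian_isHermitian (fermionTorusGraph 2 (2 * M) \
        SimpleGraph.comap (fun x : FermionTorus 2 (2 * M) => fun i : Fin 2 => ((ofLex x) i : ℕ) / 2) ⊤) 1 U) _ hcol hunit
    rw [hcolE, dotProduct_smul, hunit, smul_eq_mul, mul_one, Complex.ofReal_re] at this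
    exact this
  have hmin : Hin.minEnergyOn (szSector (Λ := FermionTorus 2 (2 * M)) ((2 * M) ^ 2 - 2 * Nb) 0) = E₀ := le_antisymm hle hge
  refine ⟨hmin, fun ψ hψ hHψ => ?_⟩
  -- part 2: a ground state has zero defect everywhere, hence is fixed by the embedded band projections
  have hψS := (hsector ψ).1 hψ
  have h1 := hform ψ hψS
  rw [hHψ, dotProduct_smul, smul_eq_mul, Complex.re_ofReal_mul] at h1
  have hsum0 : ∑ R : FermionTorus 2 M, ((star ψ ⬝ᵥ ψ).re -
      (star ψ ⬝ᵥ (jwEmbed (orbEmb (plaqSiteEmb M R)) Pb *ᵥ ψ)).re) = 0 := by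
    have := hsumnn ψ; nlinarith
  have hfixed : ∀ R : FermionTorus 2 M, jwEmbed (orbEmb (plaqSiteEmb M R)) Pb *ᵥ ψ = ψ := fun R =>
    proj_mulVec_eq_self_of_defect_eq_zero (hPR R).1 (hPR R).2
      ((Finset.sum_eq_zero_iff_of_nonneg (fun R _ => hdefect_nn ψ R)).1 hsum0 R (Finset.mem_univ R))
  -- part 2: expansion along the Koszul product states
  have hexp := eq_sum_of_fixed_by_bandProj (fun R : FermionTorus 2 M => plaqSiteEmb M R)
    (fun R R' hne => disjoint_map_plaqSiteEmb hne) card_orb_plaquette_mul_card (fun i _ => plaquetteStates U i)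
    (fun i _ => (plaquetteStates_spec U i).1) (fun i _ => 4 - 2 * (i : ℕ)) (fun i _ => isNParticle_plaquetteStates U i)
    (fun _ => star_plaquetteStates_dotProduct (U := U) (by decide : (0 : Fin 2) ≠ 1))
    (fun κ => (plaquettePartition M).prodFamily fun R => plaquetteStates U (κ R))
    (fun κ => prodFamily_plaquetteStates_unit U κ)
    (fun κ R => prodFamily_plaquetteStates_fixed U κ R) (ψ := ψ) fun R => by
      rw [jwEmbed_apply, jwEmbed_apply, ← JWEmbed.embedFun_add, ← jwEmbed_apply]
      exact hfixed R
  -- reindex assignments by spin configurations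
  set e : TensorIndex (TorusSite 2 M) 2 ≃ (FermionTorus 2 M → Fin 2) :=
    { toFun := fun σ R => (σ (FermionTorus.toTorusSite R)).rev
      invFun := fun κ y => (κ (FermionTorus.ofTorusSite y)).rev
      left_inv := fun σ => by funext y; simp
      right_inv := fun κ => by funext R; simp } with he
  have hcolκ : ∀ σ, ((plaquettePartition M).prodFamily fun R => plaquetteStates U (e σ R)) =
      (plaquettePartition M).prodFamily (plaqFamily U σ) := fun σ => rfl
  refine ⟨fun σ => star ((plaquettePartition M).prodFamily (plaqFamily U σ)) ⬝ᵥ ψ, ?_, ?_⟩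
  · -- the coefficients live on the weight `M² − N_b`
    have hiff := LiebMattis.mem_spinZSector_weight_iff (Λ := TorusSite 2 M) 1 (M ^ 2 - Nb)
      (fun σ => star ((plaquettePartition M).prodFamily (plaqFamily U σ)) ⬝ᵥ ψ)
    have hval : ((Fintype.card (TorusSite 2 M) * 1 : ℕ) : ℝ) / 2 - ((M ^ 2 - Nb : ℕ) : ℝ) =
        (Nb : ℝ) - (M : ℝ) ^ 2 / 2 := by
      rw [card_torusSite_two, Nat.cast_sub hNb]
      push_cast
      ring
    rw [hval] at hiff
    refine hiff.2 fun σ hσ => ?_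
    have hcol := col_mem_szSector U σ
    have h1 : IsNParticle (2 * (M ^ 2 + downWeight σ)) ((plaquettePartition M).prodFamily (plaqFamily U σ)) :=
      ((mem_szSector_iff _ _ _).1 hcol).1
    have h2 : IsNParticle ((2 * M) ^ 2 - 2 * Nb) ψ := ((mem_szSector_iff _ _ _).1 hψ).1
    refine dotProduct_eq_zero_of_isNParticle_ne ?_ h1 h2
    rw [downWeight, hsq]
    omega
  · rw [dictionaryMap_mulVec]
    conv_lhs => rw [hexp]
    rw [← Equiv.sum_comp e (fun κ => (star ((plaquettePartition M).prodFamily fun R => plaquetteStates U (κ R)) ⬝ᵥ ψ) •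
      (plaquettePartition M).prodFamily fun R => plaquetteStates U (κ R))]
    rfl

/-! ### Registered form -/

/-- **Registered sub-goal `dressHalfFilled_dictionaryExhaustion`** (closed form, as registered on the crux item
stmt-HubbardSuperconductivity-8148): clause (c) of `PlaquetteDictionary` for the tree's dictionary map
`TorusPlaquette.dictionaryMap M U` — on the checkerboard torus of side `2M`, `M ≥ 2`, with the plaquette data (W3)–(W5),
for every boson number `N_b ≤ M²` the sector energy of the intra-plaquette Hamiltonian on `((2M)² − 2N_b, S^z = 0)` is
`(M² − N_b) e₀ + N_b e₂`, and every sector ground state is `Φ φ` with `φ` in the spin sector `S^z_tot = N_b − M²/2`.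
[cite: TsaiKivelson2006, App. A] -/
theorem dressHalfFilled_dictionaryExhaustion : ∀ {M : ℕ} [NeZero M], 2 ≤ M → ∀ (U : ℝ), (∀ n : ℕ, n ≤ 8 → n ≠ 2 → n ≠ 4 → (4 - (n : ℝ)) * groundEnergyAt plaquetteGraph 1 U 2 + ((n : ℝ) - 2) * groundEnergyAt plaquetteGraph 1 U 4 < 2 * groundEnergyAt plaquetteGraph 1 U n) → (∀ φ₁ φ₂ : Fock (Orb PlaquetteSite), IsGroundStateInSector (plaquetteHamiltonian U) 4 0 φ₁ → IsGroundStateInSector (plaquetteHamiltonian U) 4 0 φ₂ → ∃ a : ℂ, φ₂ = a • φ₁) → (∀ φ₁ φ₂ : Fock (Orb PlaquetteSite), IsGroundStateInSector (plaquetteHamiltonian U) 2 0 φ₁ → IsGroundStateInSector (plaquetteHamiltonian U) 2 0 φ₂ → ∃ a : ℂ, φ₂ = a • φ₁) → (∀ m : ℝ, m = 1 ∨ m = -1 ∨ m = 2 ∨ m = -2 → (plaquetteHamiltonian U).minEnergyOn (szSector 4 0) < (plaquetteHamiltonian U).minEnergyOn (szSector 4 m)) → (∀ m : ℝ, m = 1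 ∨ m = -1 → (plaquetteHamiltonian U).minEnergyOn (szSector 2 0) < (plaquetteHamiltonian U).minEnergyOn (szSector 2 m)) → ∀ {Nb : ℕ}, Nb ≤ M ^ 2 → (hamiltonian (fermionTorusGraph 2 (2 * M) \ SimpleGraph.comap (fun x : FermionTorus 2 (2 * M) => fun i : Fin 2 => ((ofLex x) i : ℕ) / 2) ⊤) 1 U).minEnergyOn (szSector (Λ := FermionTorus 2 (2 * M)) ((2 * M) ^ 2 - 2 * Nb) 0) = ((M : ℝ) ^ 2 - Nb) * plaquetteEnergy U 0 + Nb * plaquetteEnergy U 2 ∧ ∀ ψ : Fock (Orb (FermionTorus 2 (2 * M))), ψ ∈ szSector (Λ := FermionTorus 2 (2 * M)) ((2 * M) ^ 2 - 2 * Nb) 0 → hamiltonian (fermionTorusGraph 2 (2 * M) \ SimpleGraph.comap (fun x : FermionTorus 2 (2 * M) => fun i : Fin 2 => ((ofLex x) i : ℕ) / 2) ⊤) 1 U *ᵥ ψ = ((((M : ℝ) ^ 2 - Nb) * plaquetteEnergy U 0 + Nb * plaquetteEnergy U 2 : ℝ) : ℂ) • ψ → ∃ φ : TensorIndex (TorusSite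 2 M) 2 → ℂ, φ ∈ spinZSector (Λ := TorusSite 2 M) 1 ((Nb : ℝ) - (M : ℝ) ^ 2 / 2) ∧ ψ = TorusPlaquette.dictionaryMap M U *ᵥ φ :=
  fun hM U hW3 hW4a hW4b hW5a hW5b _ hNb => dictionary_exhaustion hM U hW3 hW4a hW4b hW5a hW5b hNb

end Summit.HubbardSuperconductivity.HubbardSuperconductivity.Theorems.LevyLogBootstrap

end
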